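import Literature.Computability.FineGrained.KOVSplitReduction
import Literature.Computability.FineGrained.OVFromSETHSerfProofs
import HarnessLib

/-!
# SETH ⇒ `k`-OV (fine-grained.S09, `k`-list form): discharge of the named fact

`not_kOVWithDim_inTimeO_of_sethWordRAM` (`SETHHardness.lean`; V. Vassilevska Williams, ICM 2018,
§3, Thm. 3.1 with the sparsification remark: word-RAM SETH implies that `k`-OV in dimension
`c log n` requires `n^{k-o(1)}` time) is proved by the assembly
`not_kOVWithDim_inTimeO_of_sethWordRAM_of_serf` of `KOVSplitReduction.lean` (Williams' `k`-way
split-and-list reduction on the word RAM, proved there) from the sparsification lemma as a word-RAM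
SERF reduction at SETH granularity (`kSATInRAMTime_of_sparseKSATInRAMTime_serf_holds` of
`OVFromSETHSerfProofs.lean`;
Impagliazzo–Paturi–Zane, JCSS 63 (2001), Thm. 1, Cor. 1–2).

## References

* V. Vassilevska Williams, *On some fine-grained questions in algorithms and complexity*,
  Proc. ICM 2018, Vol. 3, 3431–3472, §3, Hypothesis 4 and Theorem 3.1 (with the remark on
  sparsification following its proof).
* R. Williams, *A new algorithm for optimal 2-constraint satisfaction and its implications*,
  Theoret. Comput. Sci. 348 (2005) 357–365, §5.1, Theorem 5.1 (the case `k = 2`).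
* R. Impagliazzo, R. Paturi, F. Zane, *Which problems have strongly exponential complexity?*,
  J. Comput. Syst. Sci. 63 (2001) 512–530, Theorem 1, Corollaries 1–2.
-/

namespace Literature.Computability.FineGrained

/-- **Discharge of `not_kOVWithDim_inTimeO_of_sethWordRAM`** (VVW ICM 2018, §3, Thm. 3.1 with the
sparsification remark; R. Williams, TCS 348 (2005), §5.1 for `k = 2`): assuming word-RAM SETH, for
every `k ≥ 2` and `ε > 0` there is `c ≥ 1` such that `kOVWithDim k c` has no deterministic
`O(n^{k-ε})`-time word-RAM algorithm.
[cite: VassilevskaWilliamsICM2018, §3 Thm. 3.1] [cite: WilliamsTCS2005, §5.1 Thm. 5.1] -/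
theorem not_kOVWithDim_inTimeO_of_sethWordRAM_holds : not_kOVWithDim_inTimeO_of_sethWordRAM :=
  not_kOVWithDim_inTimeO_of_sethWordRAM_of_serf kSATInRAMTime_of_sparseKSATInRAMTime_serf_holds

end Literature.Computability.FineGrained
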